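import Summits.QuantumFields.QCD.Theorems.SpectralDefectExtinctionWindowExtinctionStubInertiaMonotone
import HarnessLib

/-!
# The box block depends only on the box content (stub `stub_boxBlockReindex`)

Stub `stub_boxBlockReindex` (S8) of line `free-volume-heavy-witness` (reshape r4) of crux
`Summit.QuantumFields.QCD.Theses.SpectralDefectExtinction.WindowExtinction`
(item stmt-QuantumFields-8964).

A *template* is the content of the box `c + {−R, …, R}⁴` of an `SU(3)` gauge field `U` on the
four-torus of side `n > 2R+1`: the forward links `U(proj n (c + y), μ)`, `y ∈ box 4 R`.  The *box
block* is the principal submatrix of the Hermitian Wilson–Dirac operator `Γ₅ D_W(U, −δ, 1)` on the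
quark indices `(site, colour, spin)` over the image of the box.  The stub: two fields on two tori
(sides `n, n' > 2R+1`, centres `c, c'`) with the same content have box blocks that are re-indexings
of each other along `e : (proj n (c + y), a, α) ↦ (proj n' (c' + y), a, α)`.

* `reindex_proj_add_eq_iff`, `reindex_proj_add_eq_shift_iff` — NO WRAP-AROUND inside a box: for
  box points `y, y'` and `2R+1 < n`, `proj n (c + y') = proj n (c + y) + e_μ` iff `y' = y + e_μ` in
  `ℤ⁴` (divisibility by `n` of an integer of absolute value `≤ 2R+1 < n`); together with the
  embedding `spread_proj_add_injective` the incidence data (`p = q`, `q = p + e_μ`, `p = q + e_μ`)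
  of two box indices do not depend on the torus;
* `reindex_wilsonDirac_congr`, `reindex_hermitianWilson_congr` — an entry of `D_W` (and of
  `Γ₅ D_W = diag(ε_spin) D_W`) is determined by the incidence data of its two sites, the links based
  at them, and the colour/spin indices, uniformly in the torus (two-tori version of
  `inertia_hermitianWilson_congr`);
* `reindex_exists_boxParam` — the quark indices over the image of the box are parametrised by
  `box 4 R × (Fin 3 × Fin 4)`; the re-indexing `e` is the composite of the two parametrisations.
-/

noncomputable section

namespace Summit.QuantumFields.QCD.Cruxes.WindowExtinction.FreeVolumeHeavyWitness

open Matrix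
open Literature.MathematicalPhysics.QuantumLattice Literature.MathematicalPhysics.QuantumFieldTheory
  Literature.Probability.LatticeModels
open Literature.MathematicalPhysics (QuantumFieldTheory.Site.shift)
open scoped BigOperators Classical

/-! ## No wrap-around inside a box -/

/-- **No wrap-around inside a box.**  For `2R+1 < n`, box points `y, y' ∈ {−R, …, R}^d` and a
lattice vector `e` with entries in `[−1, 1]`: `proj n (c + y') = proj n (c + y) + proj n e` iff
`y' = y + e` in `ℤ^d` (each coordinate of `y' − y − e` is divisible by `n` and of absolute value
`≤ 2R+1 < n`). -/
theorem reindex_proj_add_eq_iff {d n R : ℕ} (hn : 2 * R + 1 < n) (c : Fin d → ℤ)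
    {y y' : Fin d → ℤ} (hy : y ∈ box d R) (hy' : y' ∈ box d R) {e : Fin d → ℤ}
    (he : ∀ k, |e k| ≤ 1) :
    Torus.proj n (c + y') = Torus.proj n (c + y) + Torus.proj n e ↔ y' = y + e := by
  rw [← spread_proj_add, spread_proj_eq_iff]
  constructor
  · intro h
    funext k
    have hdvd : (n : ℤ) ∣ y' k - y k - e k := by
      have := h k
      simp only [Pi.add_apply] at this
      have hk : c k + y' k - (c k + y k + e k) = y' k - y k - e k := by ring
      rwa [hk] at this
    have habs : |y' k - y k - e k| < n := by
      have h1 := spread_abs_le_of_mem_box hy k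
      have h2 := spread_abs_le_of_mem_box hy' k
      have h3 := he k
      have h4 : |y' k - y k - e k| ≤ |y' k - y k| + |e k| := abs_sub _ _
      have h5 : |y' k - y k| ≤ |y' k| + |y k| := abs_sub _ _
      have h6 : (2 * R + 1 : ℤ) < n := by exact_mod_cast hn
      linarith
    have h0 := Int.eq_zero_of_abs_lt_dvd hdvd habs
    rw [Pi.add_apply]
    linarith
  · rintro rfl k
    simp only [Pi.add_apply, add_assoc, sub_self, dvd_zero]

/-- **The box embeds in the torus** (iff form of `spread_proj_add_injective`): for `2R+1 ≤ n` two
box points have the same image iff they are equal. -/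
theorem reindex_proj_add_inj_iff {d n R : ℕ} (hn : 2 * R + 1 ≤ n) (c : Fin d → ℤ)
    {y y' : Fin d → ℤ} (hy : y ∈ box d R) (hy' : y' ∈ box d R) :
    Torus.proj n (c + y) = Torus.proj n (c + y') ↔ y = y' :=
  ⟨fun h => spread_proj_add_injective hn c hy hy' h, fun h => by rw [h]⟩

/-- **No wrap-around, neighbouring sites.**  For `2R+1 < n` and box points `y, y'`, the image of `y'`
is the forward `μ`-neighbour of the image of `y` on the torus iff `y' = y + e_μ` in `ℤ^d`. -/
theorem reindex_proj_add_eq_shift_iff {d n R : ℕ} (hn : 2 * R + 1 < n) (c : Fin d → ℤ)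
    {y y' : Fin d → ℤ} (hy : y ∈ box d R) (hy' : y' ∈ box d R) (μ : Fin d) :
    Torus.proj n (c + y') = QuantumFieldTheory.Site.shift (Torus.proj n (c + y)) μ ↔
      y' = y + Pi.single μ 1 := by
  rw [QuantumFieldTheory.Site.shift, ← spread_proj_single n μ]
  refine reindex_proj_add_eq_iff hn c hy hy' fun k => ?_
  by_cases h : k = μ
  · subst h; simp
  · simp [h]

/-! ## Entries of the (Hermitian) Wilson–Dirac operator across two tori -/

section Entries

variable {N : ℕ} {G : Type*} [Group G] (ρ : G →* Matrix (Fin N) (Fin N) ℂ)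

/-- **Two-tori congruence of the entries of `D_W`.**  An entry `D_W(U)_{(x,s),(z,t)}` is determined
by the incidence data of the two sites (`x = z`, `z = x + e_μ`, `x = z + e_μ`), the links based at
`x` and at `z`, and the colour/spin indices `s, t` — uniformly in the side of the torus. -/
theorem reindex_wilsonDirac_congr {n n' : ℕ} {U : GaugeConfig 4 n G} {U' : GaugeConfig 4 n' G}
    (m r : ℝ) {x z : TorusSite 4 n} {x' z' : TorusSite 4 n'} (s t : Fin N × Fin 4)
    (h0 : x' = z' ↔ x = z)
    (h1 : ∀ μ, x' = QuantumFieldTheory.Site.shift z' μ ↔ x = QuantumFieldTheory.Site.shift z μ)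
    (h2 : ∀ μ, z' = QuantumFieldTheory.Site.shift x' μ ↔ z = QuantumFieldTheory.Site.shift x μ)
    (hx : ∀ μ, U' (x', μ) = U (x, μ)) (hz : ∀ μ, U' (z', μ) = U (z, μ)) :
    wilsonDirac ρ U' m r (x', s) (z', t) = wilsonDirac ρ U m r (x, s) (z, t) := by
  simp only [wilsonDirac, Matrix.of_apply, hx, hz, Prod.mk.injEq, h0, h1, h2]

/-- **Two-tori congruence of the entries of `Γ₅ D_W`** (`Γ₅ D_W = diag(ε_spin) D_W`,
`spinorLift_gammaFive_eq_diagonal`): the two-tori version of `inertia_hermitianWilson_congr`. -/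
theorem reindex_hermitianWilson_congr {n n' : ℕ} [NeZero n] [NeZero n'] {U : GaugeConfig 4 n G}
    {U' : GaugeConfig 4 n' G} (m r : ℝ) {x z : TorusSite 4 n} {x' z' : TorusSite 4 n'}
    (s t : Fin N × Fin 4) (h0 : x' = z' ↔ x = z)
    (h1 : ∀ μ, x' = QuantumFieldTheory.Site.shift z' μ ↔ x = QuantumFieldTheory.Site.shift z μ)
    (h2 : ∀ μ, z' = QuantumFieldTheory.Site.shift x' μ ↔ z = QuantumFieldTheory.Site.shift x μ)
    (hx : ∀ μ, U' (x', μ) = U (x, μ)) (hz : ∀ μ, U' (z', μ) = U (z, μ)) :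
    (spinorLift (L := n') (N := N) gammaFive * wilsonDirac ρ U' m r) (x', s) (z', t) =
      (spinorLift (L := n) (N := N) gammaFive * wilsonDirac ρ U m r) (x, s) (z, t) := by
  simp only [spinorLift_gammaFive_eq_diagonal, diagonal_mul]
  rw [reindex_wilsonDirac_congr ρ m r s t h0 h1 h2 hx hz]

end Entries

/-! ## The quark indices over the image of a box -/

/-- **The quark indices over the image of a box are parametrised by the box.**  For `2R+1 ≤ n` the
map `(y, s) ↦ (proj n (c + y), s)` is a bijection from `box 4 R × ι` onto the indices
`(site, s)` whose site lies in the image of the box (injective by `spread_proj_add_injective`). -/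
theorem reindex_exists_boxParam {ι : Type*} {n R : ℕ} (hn : 2 * R + 1 ≤ n) (c : Fin 4 → ℤ) :
    ∃ f : ↥(box 4 R) × ι ≃
        {p : TorusSite 4 n × ι // ∃ y : ↥(box 4 R), Torus.proj n (c + (y : Fin 4 → ℤ)) = p.1},
      ∀ t, ((f t : {p : TorusSite 4 n × ι //
          ∃ y : ↥(box 4 R), Torus.proj n (c + (y : Fin 4 → ℤ)) = p.1}) : TorusSite 4 n × ι) =
        (Torus.proj n (c + (t.1 : Fin 4 → ℤ)), t.2) := by
  refine ⟨Equiv.ofBijective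
      (fun t => ⟨(Torus.proj n (c + (t.1 : Fin 4 → ℤ)), t.2), t.1, rfl⟩) ⟨?_, ?_⟩, fun t => rfl⟩
  · rintro ⟨y, s⟩ ⟨y', s'⟩ h
    simp only [Subtype.mk.injEq, Prod.mk.injEq] at h
    exact Prod.ext (Subtype.ext (spread_proj_add_injective hn c y.2 y'.2 h.1)) h.2
  · rintro ⟨⟨x, s⟩, y, hy⟩
    exact ⟨(y, s), Subtype.ext (Prod.ext hy rfl)⟩

/-! ## The stub -/

/-- **STUB S8 `stub_boxBlockReindex` (the box block depends only on the box content).**  Let `U` be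
an `SU(3)` gauge field on the four-torus of side `n > 2R+1` and `U'` one on the four-torus of side
`n' > 2R+1` with the same box content: `U'(proj n' (c' + y), μ) = U(proj n (c + y), μ)` for all
`y ∈ {−R, …, R}⁴` and all `μ`.  Then there is a bijection `e` between the quark indices over the
image of the box about `c` (torus `n`) and those over the image of the box about `c'` (torus `n'`)
along which, for every `δ`, the box block of `Γ₅ D_W(U', −δ, 1)` is the re-indexed box block of
`Γ₅ D_W(U, −δ, 1)`.  Proof: `e` is the composite of the two parametrisations by
`box 4 R × (Fin 3 × Fin 4)` (`reindex_exists_boxParam`); along it the incidence data of two indices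
agree (no wrap-around inside a box, `reindex_proj_add_eq_shift_iff`, `reindex_proj_add_inj_iff`)
and the links read agree by hypothesis, so the entries agree (`reindex_hermitianWilson_congr`). -/
theorem stub_boxBlockReindex :
    ∀ (R n : ℕ) [NeZero n] (n' : ℕ) [NeZero n'], 2 * R + 1 < n → 2 * R + 1 < n' →
      ∀ (c c' : Fin 4 → ℤ) (U : GaugeConfig 4 n SU3) (U' : GaugeConfig 4 n' SU3),
        (∀ (y : ↥(box 4 R)) (μ : Fin 4),
          U' (Torus.proj n' (c' + (y : Fin 4 → ℤ)), μ) = U (Torus.proj n (c + (y : Fin 4 → ℤ)), μ)) →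
        ∃ e : {p : TorusSite 4 n × Fin 3 × Fin 4 // ∃ y : ↥(box 4 R), Torus.proj n (c + (y : Fin 4 → ℤ)) = p.1} ≃
            {p : TorusSite 4 n' × Fin 3 × Fin 4 // ∃ y : ↥(box 4 R), Torus.proj n' (c' + (y : Fin 4 → ℤ)) = p.1},
          ∀ δ : ℝ,
            (spinorLift gammaFive * wilsonDirac (fundamentalRep (Fin 3)) U' (-δ) 1).submatrix
                (Subtype.val : {p : TorusSite 4 n' × Fin 3 × Fin 4 //
                  ∃ y : ↥(box 4 R), Torus.proj n' (c' + (y : Fin 4 → ℤ)) = p.1} → _) Subtype.val =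
              ((spinorLift gammaFive * wilsonDirac (fundamentalRep (Fin 3)) U (-δ) 1).submatrix
                (Subtype.val : {p : TorusSite 4 n × Fin 3 × Fin 4 //
                  ∃ y : ↥(box 4 R), Torus.proj n (c + (y : Fin 4 → ℤ)) = p.1} → _) Subtype.val).submatrix
                e.symm e.symm := by
  intro R n _ n' _ hn hn' c c' U U' hU
  obtain ⟨f, hf⟩ := reindex_exists_boxParam (ι := Fin 3 × Fin 4) hn.le c
  obtain ⟨f', hf'⟩ := reindex_exists_boxParam (ι := Fin 3 × Fin 4) hn'.le c'
  refine ⟨f.symm.trans f', fun δ => ?_⟩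
  ext p' q'
  obtain ⟨t, rfl⟩ := f'.surjective p'
  obtain ⟨u, rfl⟩ := f'.surjective q'
  simp only [submatrix_apply, Equiv.symm_trans_apply, Equiv.symm_symm, Equiv.symm_apply_apply,
    hf, hf']
  exact reindex_hermitianWilson_congr (fundamentalRep (Fin 3)) (-δ) 1 t.2 u.2
    (by rw [reindex_proj_add_inj_iff hn'.le c' t.1.2 u.1.2, reindex_proj_add_inj_iff hn.le c t.1.2 u.1.2])
    (fun μ => by
      rw [reindex_proj_add_eq_shift_iff hn' c' u.1.2 t.1.2, reindex_proj_add_eq_shift_iff hn c u.1.2 t.1.2])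
    (fun μ => by
      rw [reindex_proj_add_eq_shift_iff hn' c' t.1.2 u.1.2, reindex_proj_add_eq_shift_iff hn c t.1.2 u.1.2])
    (fun μ => hU t.1 μ) (fun μ => hU u.1 μ)

end Summit.QuantumFields.QCD.Cruxes.WindowExtinction.FreeVolumeHeavyWitness

end
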